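import Literature.MathematicalPhysics.QuantumFieldTheory.Balaban1983to89.B9CubeLettersGaugeTransport

/-!
# `Balaban1983to89.B9Cor36GaugeReductionCube` — T. Bałaban, *Propagators for lattice gauge theories in a background field*, Commun. Math. Phys.
# **99** (1985) 389–434 [Balaban1985BackgroundPropagators], Corollary 3.6 p. 408 ON ONE CUBE: the (3.35) gauge of a class cube makes `U^u` satisfy
# (3.37) around `1` with `α₁ = O(1)Mα₀` on the bonds of the cube, and Theorems 3.1–3.3 for the cube's letters TRANSFER from `U^u` to `U`

statement-level skeleton of published theorems with citation tags; proofs where landed; nothing here is a claim about the Yang–Mills mass gap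

PDF held: `paper:balaban1985-cmp99-background-propagators` (journal page = PDF page + 388); pp. 396, 408 read from the held text layer (`p0008.txt`, `p0020.txt`).

THE PRINT.  p. 396 (3.35): *«for an arbitrary cube □ of the described above class, and for a configuration U there exists a gauge transformation u on □
such that U^u = e^{iηA}, and if the index of □ is j, then |A| < O(1)Mα₀(Lʲη)⁻¹, |∇^ηA| < O(1)Mα₀(Lʲη)⁻² on □»*; (3.37): *«|A′| < α₁(Lʲη)⁻¹,
|∇^η_U A′| < α₁(Lʲη)⁻² on Ω_j»*.  p. 408, Corollary 3.6 and its proof: *«The above described operators defined for sequences {Ω_j ∩ □̃} and a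
configuration U satisfying the condition (3.35) satisfy also Theorems 3.1–3.3 with the constants described there. To prove the corollary let us
notice that applying the gauge transformation u we get U′ = U^u = e^{iηA} with A satisfying the inequalities in (3.35) … This implies that U′
satisfies (3.37) for the sequence {Ω′_j}, with U = 1 and α₁ = O(1)Mα₀. Thus all the operators … after the gauge transformation u, satisfy Theorems
3.1–3.3, but all the results of these theorems are gauge invariant, so they hold for the configuration U also.»*

WHY THIS FILE (cell context: G-B9-LETTERS, module M5.2 of r06's `B9-LETTERS-MAP.md` v1; consumer M5.4's knit of `B9.Cor36Printed` at def-Y's carriers).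
The cell types Cor. 3.6 over the abstract carrier (`B9.GaugeReduction335`, `B9.cor36_of_cor35`, `B9GaugeReduction335Whole`), with the gauge fixing
and the reading invariance as displayed hypotheses.  At def-Y's concrete carriers both are now theorems: the (3.35) datum of the typed class
`(bg9K 𝔸 G i).Reg335 c α₀` on a class cube (`B9BackgroundsKLevelV1.reg335Cube_of_reg335`: a gauge `u`, bi-contractive ON the cube, with
`U^u = e^{iηA}` there, `|A| < cMα₀(Lʲη)⁻¹`, `|η⁻¹∂A| < cMα₀(Lʲη)⁻²`), extended by `1` off the cube, is a bi-contraction EVERYWHERE (`‖1‖ ≤ 1`) and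
puts `U^u` in the class ★ `Small337OnCube` — (3.37) around `1` with `α₁ = c·M·α₀` on the bonds with both ends in the cube (§1–§2); and
`thms31to33IneqAt_of_gauge` (§0, on `B9CubeLettersGaugeTransport`'s exact reading invariance) transfers the block of Theorems 3.1–3.3 for covariant letters read over the invariant class
from `U^u` back to `U = (U^u)^{u⁻¹}` with the SAME constants (§3).  The remaining printed input — Theorems 3.1–3.3 for the CUBE'S letters at every
configuration of `Small337OnCube` (Sect. B–G for the sequence {Ω_j ∩ □̃}; the letters are local to the cube, so nothing is asked off it) — is the
displayed hypothesis `hroot` of ★★ `thms31to33_cube_of_reg335` (M5.1b's staged root inhabits it); the cube letters themselves (`Gp`, `GA`, `C` with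
their covariance laws) are parameters (M5.1a ∕ M5.3 construct them).  Nothing of the class, the gauge action or the readings is restated.

WHAT IS PROVED (all `theorem`s, no `sorry`).  §0 `siteKernel_iSup_conj`, `siteKernelOfOp_abs_eq` ((3.48) kernel entries equal at `U^u` and `U`),
★★ `thms31to33IneqAt_of_gauge` (the block `B9.Thms31to33IneqAt` for covariant letters read over the invariant class transfers from `V` to `U`,
`cfg U = (cfg V)^u`, SAME constants — by `B9GaugeReduction335Whole.thms31to33IneqAt_of_invariant` on `B9CubeLettersGaugeTransport`); §1
`Small337OnCube` (definition); §2 ★ `exists_gauge_small337_of_reg335Cube`,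
`exists_gauge_small337_of_reg335`; §3 ★★ `thms31to33_cube_of_reg335'` (any backgrounds record with a gauge action read through `cfg`) and
★★ `thms31to33_cube_of_reg335` (def-Y's `bg9K 𝔸 G i`, `cfg = id`); §4 (v1.1) `siteKernelOfOp_abs_eq'`, ★★ `thms31to33IneqAt_of_gauge'`,
★★ `thms31to33_cube_of_reg335''` — the same three with the block letter `C` over ARBITRARY block carriers `Xc, Yc` (the cube's own blocks, p. 409 `C_□(U)`).
-/

noncomputable section

namespace Literature.MathematicalPhysics.QuantumFieldTheory.Balaban1983to89.B9Cor36GaugeReductionCube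

open Node00 B9CubeLettersInvReadings B9CubeLettersGaugeTransport
open B9GaugeReduction335Whole (thms31to33IneqAt_of_invariant)
open B9Eq39Adjoint (R covD fluct)
open B6KLevelCensusIndexV1 (KIdx kGeo)
open B6GlobalChartV1 (PV)
open B9BackgroundsKLevelV1 (bg9K cubeClass396 shiftsV1 reg335Cube_of_reg335)
open LatticeNorms (scaleLen)
open scoped Matrix

variable {d ℓ : ℕ} {hd : 1 ≤ d + 1} {hL : Odd (ℓ + 1) ∧ 1 < ℓ + 1} {b₀ b₁ : ℝ}
variable {𝔸 : Type} [NormedRing 𝔸] [NormedAlgebra ℂ 𝔸] [CompleteSpace 𝔸]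

/-! ## §0 The (3.48) kernel reading is gauge invariant; the block of Theorems 3.1–3.3 transfers along a bi-contractive gauge function -/

section Transfer

variable (i : KIdx d ℓ hd hL b₀ b₁)

/-- **THE (3.48) KERNEL READING IS GAUGE INVARIANT**: for a letter `O(U) : (Y → 𝔸) → (X → 𝔸)` intertwining `R(u_Y)` and `R(u_X)` with bi-contractive
`u_X, u_Y`, `sup_E ‖(O(U^u)(δ_w ⊗ E))(x)‖ = sup_E ‖(O(U)(δ_w ⊗ E))(x)‖` (`R(u_Y)⁻¹(δ_w ⊗ E) = δ_w ⊗ R(u_Y(w))⁻¹E` re-indexes the ball).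
[cite: Balaban1985BackgroundPropagators, (3.48) p.398, (3.33) p.396 + p.398 (gauge invariance)] -/
theorem siteKernel_iSup_conj (V : CfgY 𝔸 i) {X Y : Type} (O : CfgY 𝔸 i → (Y → 𝔸) →ₗ[ℂ] (X → 𝔸)) {γX : X → 𝔸ˣ} {γY : Y → 𝔸ˣ} (hX : IsBiContr γX)
    (hY : IsBiContr γY) {U' : CfgY 𝔸 i} (hO : Intw (conjY γY) (conjY γX) (O V) (O U')) (x : X) (w : Y) :
    (⨆ E : BallY 𝔸, ‖O U' (deltaY w (E : 𝔸)) x‖) = ⨆ E : BallY 𝔸, ‖O V (deltaY w (E : 𝔸)) x‖ := by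
  refine (Equiv.iSup_congr (ballConj hY w) fun E => ?_).symm
  rw [ballConj_coe, ← deltaY_conj, hO.apply, conjY_apply, hX.norm_R]

variable {B : B9.Backgrounds} (cfg : B.Cfg → CfgY 𝔸 i) {g : GaugeY 𝔸 i} {U V : B.Cfg}

/-- **THE (3.48) KERNEL OF A COVARIANT BLOCK LETTER HAS GAUGE-INVARIANT ENTRIES**: for `C(U) : (BlkY → 𝔸) → (BlkY → 𝔸)` with
`C(U^u)R(u) = R(u)C(U)` (def-Y's `CY_cov` for `(Q′G′²Q′*)⁻¹`), `|siteKernelOfOp … C β β (U)(b, b′)| = |…(V)(b, b′)|`.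
[cite: Balaban1985BackgroundPropagators, (3.48) p.398, (3.33) p.396 + p.408 («all the results of these theorems are gauge invariant»)] -/
theorem siteKernelOfOp_abs_eq {C : CfgY 𝔸 i → (BlkY i → 𝔸) →ₗ[ℂ] (BlkY i → 𝔸)}
    (hC : ∀ (g : GaugeY 𝔸 i) (W : CfgY 𝔸 i), Intw (conjY (gBlkY i g)) (conjY (gBlkY i g)) (C W) (C (gaugeY i g W)))
    (ix iy : IBondY i → BlkY i) (hg : IsBiContr g) (hUV : cfg U = gaugeY i g (cfg V)) (b b' : IBondY i) :
    |(siteKernelOfOp i B cfg C ix iy).ker U b b'| = |(siteKernelOfOp i B cfg C ix iy).ker V b b'| := by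
  show |⨆ E : BallY 𝔸, ‖C (cfg U) (deltaY (iy b') (E : 𝔸)) (ix b)‖| = |⨆ E : BallY 𝔸, ‖C (cfg V) (deltaY (iy b') (E : 𝔸)) (ix b)‖|
  rw [hUV, siteKernel_iSup_conj i (cfg V) C (hg.blk i) (hg.blk i) (hC g (cfg V))]

/-- ★★ **«ALL THE RESULTS OF THESE THEOREMS ARE GAUGE INVARIANT, SO THEY HOLD FOR THE CONFIGURATION U ALSO» (p. 408), FOR def-Y's LETTERS**:
the block `B9.Thms31to33IneqAt` (Theorems 3.1–3.3 at one configuration: (3.42)–(3.47) for a covariant site-sector letter `Gp` and a covariant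
bond-sector letter `GA` read over the invariant class, (3.48) for a covariant block letter `C`) with ANY constants transfers from `V` to `U`
whenever `cfg U = (cfg V)^u` for a bi-contractive gauge function `u` — the SAME constants. [cite: Balaban1985BackgroundPropagators, Thms 3.1–3.3 pp.397–399 + p.398 + Cor. 3.6 p.408] -/
theorem thms31to33IneqAt_of_gauge {dd : ℕ} {Gp : SiteOpY 𝔸 i} (hGp : IsCovSiteOpY i Gp) {GA : BondOpY 𝔸 i} (hGA : IsCovBondOpY i GA)
    {parS : SiteParY 𝔸 i} (hS : IsGaugeLawS i parS) {parB : BondParY 𝔸 i} (hB : IsGaugeLawB i parB)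
    {C : CfgY 𝔸 i → (BlkY i → 𝔸) →ₗ[ℂ] (BlkY i → 𝔸)}
    (hC : ∀ (g : GaugeY 𝔸 i) (W : CfgY 𝔸 i), Intw (conjY (gBlkY i g)) (conjY (gBlkY i g)) (C W) (C (gaugeY i g W)))
    (ix iy : IBondY i → BlkY i) (hg : IsBiContr g) (hUV : cfg U = gaugeY i g (cfg V))
    {B₀ δ₀ : ℝ} {Bβ Bε : ℝ → ℝ} {Bεβ : ℝ → ℝ → ℝ} {B₁ δ₁ : ℝ}
    (h : B9.Thms31to33IneqAt dd (kernelFamilySInv i B cfg Gp parS) (kernelFamilyBInv i B cfg GA parB) (siteKernelOfOp i B cfg C ix iy)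
      B₀ δ₀ Bβ Bε Bεβ B₁ δ₁ V) :
    B9.Thms31to33IneqAt dd (kernelFamilySInv i B cfg Gp parS) (kernelFamilyBInv i B cfg GA parB) (siteKernelOfOp i B cfg C ix iy)
      B₀ δ₀ Bβ Bε Bεβ B₁ δ₁ U :=
  thms31to33IneqAt_of_invariant (kernelReadingsInvariant_SInv i cfg hGp hS hg hUV) (kernelReadingsInvariant_BInv i cfg hGA hB hg hUV)
    (siteKernelOfOp_abs_eq i cfg hC ix iy hg hUV) h

end Transfer

variable (i : KIdx d ℓ hd hL b₀ b₁)

/-! ## §1 (3.37) around `1` on the bonds of a cube -/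

/-- ★ **(3.37) AROUND `1` WITH `α₁` ON THE BONDS OF THE CUBE `□` OF INDEX `j`**: `V = e^{iηA}` on every bond with both ends in `□`, with
`|A| < α₁(Lʲη)⁻¹` and `|η⁻¹∂A| < α₁(Lʲη)⁻²` on `□` (`∇^η_1 = η⁻¹∂`, the `U = 1` case of (3.37); `η, L` of the member's geometry `kGeo i`).
[cite: Balaban1985BackgroundPropagators, (3.37) p.396 (with U = 1), Cor. 3.6 p.408 («U′ satisfies (3.37) … with U = 1 and α₁ = O(1)Mα₀»)] -/
def Small337OnCube (cube : Set (Site (PV d ℓ i.m i.K hd hL) 0)) (j : ℕ) (α₁ : ℝ) (V : CfgY 𝔸 i) : Prop :=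
  ∃ A : Fin (PV d ℓ i.m i.K hd hL).d → Site (PV d ℓ i.m i.K hd hL) 0 → 𝔸,
    (∀ (κ : Fin (PV d ℓ i.m i.K hd hL).d) (x : Site (PV d ℓ i.m i.K hd hL) 0), x ∈ cube → x.shift κ ∈ cube →
        V κ x = fluct (kGeo i).eta A κ x) ∧
    (∀ κ, ∀ z ∈ cube, ‖A κ z‖ < α₁ * (scaleLen (kGeo i).L (kGeo i).eta j)⁻¹) ∧
    (∀ κ ν, ∀ z ∈ cube, ‖(((kGeo i).eta : ℂ)⁻¹) • covD (shiftsV1 _) (fun _ _ => (1 : 𝔸ˣ)) κ (A ν) z‖ < α₁ * ((scaleLen (kGeo i).L (kGeo i).eta j) ^ 2)⁻¹)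

/-! ## §2 The (3.35) gauge of a class cube puts `U^u` in the class (3.37) around `1` on the cube, `α₁ = c·M·α₀` -/

/-- ★ **FROM THE (3.35) DATUM ON A CUBE**: the datum's gauge `u` (a bi-contraction on the cube) extended by `1` off the cube is a bi-contraction
everywhere (`‖1‖ ≤ 1`), and `U^u` satisfies (3.37) around `1` with the datum's constant on the bonds of the cube.
[cite: Balaban1985BackgroundPropagators, (3.35) p.396, Cor. 3.6 p.408 («applying the gauge transformation u we get U′ = U^u = e^{iηA}»)] -/
theorem exists_gauge_small337_of_reg335Cube (h1 : ‖(1 : 𝔸)‖ ≤ 1) {U : CfgY 𝔸 i} {cube : Set (Site (PV d ℓ i.m i.K hd hL) 0)} {j : ℕ} {C : ℝ}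
    (h : B9Eq335RegularityClasses.Reg335Cube (shiftsV1 _) U (kGeo i).eta cube (scaleLen (kGeo i).L (kGeo i).eta j) C) :
    ∃ g : GaugeY 𝔸 i, IsBiContr g ∧ Small337OnCube i cube j C (gaugeY i g U) := by
  classical
  obtain ⟨u, A, hu, hgA, hA, hdA⟩ := h
  refine ⟨fun x => if x ∈ cube then u x else 1, fun x => ?_, A, fun κ x hx hx' => ?_, hA, hdA⟩
  · by_cases hx : x ∈ cube
    · simp only [if_pos hx]; exact hu x hx
    · simp only [if_neg hx]; exact ⟨by rw [Units.val_one]; exact h1, by rw [inv_one, Units.val_one]; exact h1⟩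
  · simp only [gaugeY_apply, if_pos hx, if_pos hx']
    rw [← hgA κ x hx, B9Eq3117Current.gaugeTr_apply]
    rfl

/-- ★ **THE (3.35) GAUGE OF A CLASS CUBE**: for `U` in def-Y's class `(bg9K 𝔸 G i).Reg335 c α₀` and a cube `□` of the class of p. 396 with index `j`,
there is a bi-contractive gauge function `u` on the torus with `U^u` in the class (3.37) around `1` on `□`, `α₁ = c·M·α₀`.
[cite: Balaban1985BackgroundPropagators, (3.35) p.396, Cor. 3.6 p.408 («with U = 1 and α₁ = O(1)Mα₀»)] -/
theorem exists_gauge_small337_of_reg335 {G : Subgroup 𝔸ˣ} (h1 : ‖(1 : 𝔸)‖ ≤ 1) {c α₀ : ℝ} {U : CfgY 𝔸 i} (hreg : (bg9K 𝔸 G i).Reg335 c α₀ U)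
    {q : Set (Site (PV d ℓ i.m i.K hd hL) 0) × ℕ} (hq : q ∈ cubeClass396 i) :
    ∃ g : GaugeY 𝔸 i, IsBiContr g ∧ Small337OnCube i q.1 q.2 (c * (kGeo i).M * α₀) (gaugeY i g U) :=
  exists_gauge_small337_of_reg335Cube i h1 (reg335Cube_of_reg335 i hreg hq)

/-! ## §3 Corollary 3.6 on one cube: Theorems 3.1–3.3 for the cube's letters transfer from `U^u` to `U` -/

/-- ★★ **COROLLARY 3.6 ON ONE CUBE, over a backgrounds record with a gauge action read through `cfg`**: for covariant cube letters `Gp` (site sector),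
`GA` (bond sector), `C` (block letter) with lawful Hölder transporters, IF Theorems 3.1–3.3 hold for them at every configuration of the class (3.37)
around `1` with `α₁ = c·M·α₀` on the class cube `□` (`hroot` — Sect. B–G for {Ω_j ∩ □̃}, the printed input), THEN they hold, with the SAME constants,
at every `U` of the class (3.35): gauge to `U^u` (§2), apply `hroot`, transfer back along `u⁻¹` (`thms31to33IneqAt_of_gauge`).
[cite: Balaban1985BackgroundPropagators, Cor. 3.6 p.408] -/
theorem thms31to33_cube_of_reg335' {G : Subgroup 𝔸ˣ} (h1 : ‖(1 : 𝔸)‖ ≤ 1) {B : B9.Backgrounds} (cfg : B.Cfg → CfgY 𝔸 i)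
    (act : GaugeY 𝔸 i → B.Cfg → B.Cfg) (hact : ∀ (g : GaugeY 𝔸 i) (W : B.Cfg), cfg (act g W) = gaugeY i g (cfg W))
    {c α₀ : ℝ} {U : B.Cfg} (hreg : (bg9K 𝔸 G i).Reg335 c α₀ (cfg U)) {q : Set (Site (PV d ℓ i.m i.K hd hL) 0) × ℕ} (hq : q ∈ cubeClass396 i)
    {Gp : SiteOpY 𝔸 i} (hGp : IsCovSiteOpY i Gp) {GA : BondOpY 𝔸 i} (hGA : IsCovBondOpY i GA)
    {parS : SiteParY 𝔸 i} (hS : IsGaugeLawS i parS) {parB : BondParY 𝔸 i} (hB : IsGaugeLawB i parB)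
    {C : CfgY 𝔸 i → (BlkY i → 𝔸) →ₗ[ℂ] (BlkY i → 𝔸)}
    (hC : ∀ (g : GaugeY 𝔸 i) (W : CfgY 𝔸 i), Intw (conjY (gBlkY i g)) (conjY (gBlkY i g)) (C W) (C (gaugeY i g W)))
    (ix iy : IBondY i → BlkY i) {dd : ℕ} {B₀ δ₀ : ℝ} {Bβ Bε : ℝ → ℝ} {Bεβ : ℝ → ℝ → ℝ} {B₁ δ₁ : ℝ}
    (hroot : ∀ V : B.Cfg, Small337OnCube i q.1 q.2 (c * (kGeo i).M * α₀) (cfg V) →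
      B9.Thms31to33IneqAt dd (kernelFamilySInv i B cfg Gp parS) (kernelFamilyBInv i B cfg GA parB) (siteKernelOfOp i B cfg C ix iy)
        B₀ δ₀ Bβ Bε Bεβ B₁ δ₁ V) :
    B9.Thms31to33IneqAt dd (kernelFamilySInv i B cfg Gp parS) (kernelFamilyBInv i B cfg GA parB) (siteKernelOfOp i B cfg C ix iy)
      B₀ δ₀ Bβ Bε Bεβ B₁ δ₁ U := by
  obtain ⟨g, hg, hsmall⟩ := exists_gauge_small337_of_reg335 i h1 hreg hq
  have hUV : cfg U = gaugeY i g⁻¹ (cfg (act g U)) := by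
    rw [hact]
    show cfg U = gaugeV g⁻¹ (gaugeV g (cfg U))
    rw [← gaugeV_mul, inv_mul_cancel, gaugeV_one]
  rw [← hact] at hsmall
  exact thms31to33IneqAt_of_gauge i cfg hGp hGA hS hB hC ix iy hg.inv hUV (hroot _ hsmall)

/-- ★★ **COROLLARY 3.6 ON ONE CUBE, def-Y's backgrounds `bg9K 𝔸 G i` read identically** (the shape of def-Y's layer: `cfg = fun U => U`): for `U` in the
class (3.35) with `α₀`, a class cube `□`, covariant cube letters, and Theorems 3.1–3.3 for them on the class (3.37) around `1` with `α₁ = c·M·α₀` on `□`,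
Theorems 3.1–3.3 hold for them at `U` with the same constants. [cite: Balaban1985BackgroundPropagators, Cor. 3.6 p.408] -/
theorem thms31to33_cube_of_reg335 {G : Subgroup 𝔸ˣ} (h1 : ‖(1 : 𝔸)‖ ≤ 1) {c α₀ : ℝ} {U : CfgY 𝔸 i} (hreg : (bg9K 𝔸 G i).Reg335 c α₀ U)
    {q : Set (Site (PV d ℓ i.m i.K hd hL) 0) × ℕ} (hq : q ∈ cubeClass396 i)
    {Gp : SiteOpY 𝔸 i} (hGp : IsCovSiteOpY i Gp) {GA : BondOpY 𝔸 i} (hGA : IsCovBondOpY i GA)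
    {parS : SiteParY 𝔸 i} (hS : IsGaugeLawS i parS) {parB : BondParY 𝔸 i} (hB : IsGaugeLawB i parB)
    {C : CfgY 𝔸 i → (BlkY i → 𝔸) →ₗ[ℂ] (BlkY i → 𝔸)}
    (hC : ∀ (g : GaugeY 𝔸 i) (W : CfgY 𝔸 i), Intw (conjY (gBlkY i g)) (conjY (gBlkY i g)) (C W) (C (gaugeY i g W)))
    (ix iy : IBondY i → BlkY i) {dd : ℕ} {B₀ δ₀ : ℝ} {Bβ Bε : ℝ → ℝ} {Bεβ : ℝ → ℝ → ℝ} {B₁ δ₁ : ℝ}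
    (hroot : ∀ V : CfgY 𝔸 i, Small337OnCube i q.1 q.2 (c * (kGeo i).M * α₀) V →
      B9.Thms31to33IneqAt dd (kernelFamilySInv i (bg9K 𝔸 G i) (fun W => W) Gp parS) (kernelFamilyBInv i (bg9K 𝔸 G i) (fun W => W) GA parB)
        (siteKernelOfOp i (bg9K 𝔸 G i) (fun W => W) C ix iy) B₀ δ₀ Bβ Bε Bεβ B₁ δ₁ V) :
    B9.Thms31to33IneqAt dd (kernelFamilySInv i (bg9K 𝔸 G i) (fun W => W) Gp parS) (kernelFamilyBInv i (bg9K 𝔸 G i) (fun W => W) GA parB)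
      (siteKernelOfOp i (bg9K 𝔸 G i) (fun W => W) C ix iy) B₀ δ₀ Bβ Bε Bεβ B₁ δ₁ U :=
  thms31to33_cube_of_reg335' i h1 (B := bg9K 𝔸 G i) (fun W => W) (gaugeY i) (fun _ _ => rfl) hreg hq hGp hGA hS hB hC ix iy hroot

/-! ## §4 (v1.1) The block letter `C` over an ARBITRARY block carrier (the cube blocks `Blk_□` of the local `C_□(U) = (Q′G′_□²Q′*)⁻¹(U)`, p. 409)

p. 409: *«The operators constructed for this sequence, which we denote by G′_□(U), C_□(U) = (Q′(U)G′_□²(U)Q′*(U))⁻¹, G_□(U), satisfy all the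
inequalities of Theorems 3.1–3.3 correspondingly.»*  The cube operator `C_□(U)` acts on functions on the blocks of the CUBE'S sequence {Ω_n(□)}, not
on the member's blocks; def-Y's reading `Node00.OpsYOfLetters.siteKernelOfOp B cfg O ix iy` is already generic in the carriers of `O`, and so is
`siteKernel_iSup_conj` (§0).  The three §0∕§3 statements are repeated here with the block letter `C : CfgY 𝔸 i → (Yc → 𝔸) →ₗ[ℂ] (Xc → 𝔸)` over
arbitrary carriers `Xc, Yc`, gauge functions read there through `γX g, γY g` (bi-contractive whenever `g` is) — the v1 statements are the case
`Xc = Yc = BlkY i`, `γX = γY = gBlkY i` (cell record: r05 g77 M5.1c PART 2 (P4), decision (α)).  Nothing else changes. -/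

section TransferGeneric

variable {B : B9.Backgrounds} (cfg : B.Cfg → CfgY 𝔸 i) {g : GaugeY 𝔸 i} {U V : B.Cfg}

/-- **THE (3.48) KERNEL OF A COVARIANT BLOCK LETTER OVER ANY BLOCK CARRIER HAS GAUGE-INVARIANT ENTRIES** (`siteKernelOfOp_abs_eq` with the
carriers `Xc, Yc` of `C` and the gauge functions `γX g, γY g` read there as parameters). [cite: Balaban1985BackgroundPropagators, (3.48) p.398, (3.33) p.396 + p.408 («all the results of these theorems are gauge invariant»), p.409 (C_□(U))] -/
theorem siteKernelOfOp_abs_eq' {Xc Yc : Type} {C : CfgY 𝔸 i → (Yc → 𝔸) →ₗ[ℂ] (Xc → 𝔸)} (γX : GaugeY 𝔸 i → Xc → 𝔸ˣ) (γY : GaugeY 𝔸 i → Yc → 𝔸ˣ)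
    (hγX : IsBiContr (γX g)) (hγY : IsBiContr (γY g))
    (hC : ∀ (g : GaugeY 𝔸 i) (W : CfgY 𝔸 i), Intw (conjY (γY g)) (conjY (γX g)) (C W) (C (gaugeY i g W)))
    (ix : IBondY i → Xc) (iy : IBondY i → Yc) (hUV : cfg U = gaugeY i g (cfg V)) (b b' : IBondY i) :
    |(siteKernelOfOp i B cfg C ix iy).ker U b b'| = |(siteKernelOfOp i B cfg C ix iy).ker V b b'| := by
  show |⨆ E : BallY 𝔸, ‖C (cfg U) (deltaY (iy b') (E : 𝔸)) (ix b)‖| = |⨆ E : BallY 𝔸, ‖C (cfg V) (deltaY (iy b') (E : 𝔸)) (ix b)‖|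
  rw [hUV, siteKernel_iSup_conj i (cfg V) C hγX hγY (hC g (cfg V))]

/-- ★★ **THE BLOCK OF THEOREMS 3.1–3.3 TRANSFERS ALONG A BI-CONTRACTIVE GAUGE FUNCTION, the block letter `C` over any block carrier**
(`thms31to33IneqAt_of_gauge` with `Xc, Yc, γX, γY` as parameters; SAME constants). [cite: Balaban1985BackgroundPropagators, Thms 3.1–3.3 pp.397–399 + p.398 + Cor. 3.6 p.408, p.409 (C_□(U))] -/
theorem thms31to33IneqAt_of_gauge' {dd : ℕ} {Gp : SiteOpY 𝔸 i} (hGp : IsCovSiteOpY i Gp) {GA : BondOpY 𝔸 i} (hGA : IsCovBondOpY i GA)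
    {parS : SiteParY 𝔸 i} (hS : IsGaugeLawS i parS) {parB : BondParY 𝔸 i} (hB : IsGaugeLawB i parB)
    {Xc Yc : Type} {C : CfgY 𝔸 i → (Yc → 𝔸) →ₗ[ℂ] (Xc → 𝔸)} (γX : GaugeY 𝔸 i → Xc → 𝔸ˣ) (γY : GaugeY 𝔸 i → Yc → 𝔸ˣ)
    (hγX : ∀ g : GaugeY 𝔸 i, IsBiContr g → IsBiContr (γX g)) (hγY : ∀ g : GaugeY 𝔸 i, IsBiContr g → IsBiContr (γY g))
    (hC : ∀ (g : GaugeY 𝔸 i) (W : CfgY 𝔸 i), Intw (conjY (γY g)) (conjY (γX g)) (C W) (C (gaugeY i g W)))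
    (ix : IBondY i → Xc) (iy : IBondY i → Yc) (hg : IsBiContr g) (hUV : cfg U = gaugeY i g (cfg V))
    {B₀ δ₀ : ℝ} {Bβ Bε : ℝ → ℝ} {Bεβ : ℝ → ℝ → ℝ} {B₁ δ₁ : ℝ}
    (h : B9.Thms31to33IneqAt dd (kernelFamilySInv i B cfg Gp parS) (kernelFamilyBInv i B cfg GA parB) (siteKernelOfOp i B cfg C ix iy)
      B₀ δ₀ Bβ Bε Bεβ B₁ δ₁ V) :
    B9.Thms31to33IneqAt dd (kernelFamilySInv i B cfg Gp parS) (kernelFamilyBInv i B cfg GA parB) (siteKernelOfOp i B cfg C ix iy)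
      B₀ δ₀ Bβ Bε Bεβ B₁ δ₁ U :=
  thms31to33IneqAt_of_invariant (kernelReadingsInvariant_SInv i cfg hGp hS hg hUV) (kernelReadingsInvariant_BInv i cfg hGA hB hg hUV)
    (siteKernelOfOp_abs_eq' i cfg γX γY (hγX g hg) (hγY g hg) hC ix iy hUV) h

/-- ★★ **COROLLARY 3.6 ON ONE CUBE OF THE (3.35) CLASS, the block letter `C` over any block carrier** (`thms31to33_cube_of_reg335'` with
`Xc, Yc, γX, γY` as parameters: the cube's `C_□(U)` on the blocks of its own sequence {Ω_n(□)}). [cite: Balaban1985BackgroundPropagators, Cor. 3.6 p.408, p.409 (G′_□(U), C_□(U), G_□(U))] -/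
theorem thms31to33_cube_of_reg335'' {G : Subgroup 𝔸ˣ} (h1 : ‖(1 : 𝔸)‖ ≤ 1) {B : B9.Backgrounds} (cfg : B.Cfg → CfgY 𝔸 i)
    (act : GaugeY 𝔸 i → B.Cfg → B.Cfg) (hact : ∀ (g : GaugeY 𝔸 i) (W : B.Cfg), cfg (act g W) = gaugeY i g (cfg W))
    {c α₀ : ℝ} {U : B.Cfg} (hreg : (bg9K 𝔸 G i).Reg335 c α₀ (cfg U)) {q : Set (Site (PV d ℓ i.m i.K hd hL) 0) × ℕ} (hq : q ∈ cubeClass396 i)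
    {Gp : SiteOpY 𝔸 i} (hGp : IsCovSiteOpY i Gp) {GA : BondOpY 𝔸 i} (hGA : IsCovBondOpY i GA)
    {parS : SiteParY 𝔸 i} (hS : IsGaugeLawS i parS) {parB : BondParY 𝔸 i} (hB : IsGaugeLawB i parB)
    {Xc Yc : Type} {C : CfgY 𝔸 i → (Yc → 𝔸) →ₗ[ℂ] (Xc → 𝔸)} (γX : GaugeY 𝔸 i → Xc → 𝔸ˣ) (γY : GaugeY 𝔸 i → Yc → 𝔸ˣ)
    (hγX : ∀ g : GaugeY 𝔸 i, IsBiContr g → IsBiContr (γX g)) (hγY : ∀ g : GaugeY 𝔸 i, IsBiContr g → IsBiContr (γY g))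
    (hC : ∀ (g : GaugeY 𝔸 i) (W : CfgY 𝔸 i), Intw (conjY (γY g)) (conjY (γX g)) (C W) (C (gaugeY i g W)))
    (ix : IBondY i → Xc) (iy : IBondY i → Yc) {dd : ℕ} {B₀ δ₀ : ℝ} {Bβ Bε : ℝ → ℝ} {Bεβ : ℝ → ℝ → ℝ} {B₁ δ₁ : ℝ}
    (hroot : ∀ V : B.Cfg, Small337OnCube i q.1 q.2 (c * (kGeo i).M * α₀) (cfg V) →
      B9.Thms31to33IneqAt dd (kernelFamilySInv i B cfg Gp parS) (kernelFamilyBInv i B cfg GA parB) (siteKernelOfOp i B cfg C ix iy)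
        B₀ δ₀ Bβ Bε Bεβ B₁ δ₁ V) :
    B9.Thms31to33IneqAt dd (kernelFamilySInv i B cfg Gp parS) (kernelFamilyBInv i B cfg GA parB) (siteKernelOfOp i B cfg C ix iy)
      B₀ δ₀ Bβ Bε Bεβ B₁ δ₁ U := by
  obtain ⟨g, hg, hsmall⟩ := exists_gauge_small337_of_reg335 i h1 hreg hq
  have hUV : cfg U = gaugeY i g⁻¹ (cfg (act g U)) := by
    rw [hact]
    show cfg U = gaugeV g⁻¹ (gaugeV g (cfg U))
    rw [← gaugeV_mul, inv_mul_cancel, gaugeV_one]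
  rw [← hact] at hsmall
  exact thms31to33IneqAt_of_gauge' i cfg hGp hGA hS hB γX γY hγX hγY hC ix iy hg.inv hUV (hroot _ hsmall)

end TransferGeneric

end Literature.MathematicalPhysics.QuantumFieldTheory.Balaban1983to89.B9Cor36GaugeReductionCube

end
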